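import Mathlib
import HarnessLib
import Summits.ValiantsHypothesis.ValiantsHypothesis.Theses.MonotoneRestoration
import Literature.Computability.AlgebraicComplexity.ArithCircuit
import Literature.Computability.AlgebraicComplexity.ArithCircuitProofs
import Literature.Computability.AlgebraicComplexity.MonotoneStructure
import Literature.Computability.AlgebraicComplexity.PermanentIrreducible
import Literature.ModelTheory.FiniteModelTheory.CkEquiv
import Summits.ValiantsHypothesis.ValiantsHypothesis.Theorems.MonotoneRestorationMonotoneRestorationQPCosetCount
import Summits.ValiantsHypothesis.ValiantsHypothesis.Theorems.MonotoneRestorationMonotoneRestorationQPSymmetricLB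
import Summits.ValiantsHypothesis.ValiantsHypothesis.Theorems.MonotoneRestorationMonotoneRestorationQPSupportSymmetrisation
import Summits.ValiantsHypothesis.ValiantsHypothesis.Theorems.MonotoneRestorationMonotoneRestorationQPSparseRegime
import Summits.ValiantsHypothesis.ValiantsHypothesis.Theorems.MonotoneRestorationMonotoneRestorationQPBeta
import Literature.Computability.AlgebraicComplexity.SymmetricArithCircuit
import Literature.Computability.AlgebraicComplexity.DawarWilsenach2025Proofs
import Literature.GroupTheory.PermutationGroups.SmallIndexSubgroups
import Summits.ValiantsHypothesis.ValiantsHypothesis.Theorems.MonotoneRestorationQP.Negative.LoadBearing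
import Summits.ValiantsHypothesis.ValiantsHypothesis.Theorems.MonotoneRestorationMonotoneRestorationQPPermSupportCount
import Summits.ValiantsHypothesis.ValiantsHypothesis.Theorems.MonotoneRestorationMonotoneRestorationQPEsymmRowSumsComplexity

/-! TTRL-lite variant V20224 of stmt-ValiantsHypothesis-15886 -/

set_option linter.dupNamespace false

namespace Summit.ValiantsHypothesis.ValiantsHypothesis.Theorems

open Summit.ValiantsHypothesis.ValiantsHypothesis.Theses.MonotoneRestoration
open Literature.Computability.AlgebraicComplexity

/-- TTRL-lite variant V20224 of `stmt-ValiantsHypothesis-15886` (stub `stub_esymmRowSums_complexity`,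
first `have` of the landed proof): on top of ANY fan-in-`≤ 2` gate list `gs` over `ℝ≥0` in the
`n × n` matrix variables, `n (n + 1)` more fan-in-`≤ 2` gates provide all `n` row sums
`R_i = Σ_j X (i, j)` (`0`, then `+ X (i, j)` one variable at a time, `n + 1` gates per row).
Immediate from the tree's `esymmRowSumsCplx_allRows` with `S = T = univ`.
[cite: JerrumSnir1982, §2 (elementary symmetric functions)] -/
theorem stub_esymmRowSums_complexity_var20224 :
    ∀ (n : ℕ) (gs : List (ArithCircuit.Gate NNReal (Fin n × Fin n))), (∀ g ∈ gs, g.fanIn ≤ 2) →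
      ∃ gs' : List (ArithCircuit.Gate NNReal (Fin n × Fin n)), gs <+: gs' ∧
        (∀ g ∈ gs', g.fanIn ≤ 2) ∧ gs'.length = gs.length + n * (n + 1) ∧
        ∀ i : Fin n, (∑ j : Fin n, (MvPolynomial.X (i, j) : MvPolynomial (Fin n × Fin n) NNReal)) ∈
          ArithCircuit.gateValues gs' := by
  intro n gs hfan
  obtain ⟨gs', hpre, hfan', hlen, hrows⟩ := esymmRowSumsCplx_allRows (k := NNReal)
    (fun i j : Fin n => (i, j)) Finset.univ Finset.univ gs hfan
  refine ⟨gs', hpre, hfan', ?_, fun i => hrows i (Finset.mem_univ i)⟩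
  simpa only [Finset.card_univ, Fintype.card_fin] using hlen

end Summit.ValiantsHypothesis.ValiantsHypothesis.Theorems
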